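import Mathlib
import HarnessLib

/-!
# ValuationSeparability (crux `IndSmooth.ValuativeSmoothing`, stmt-ResolutionOfSingularities-16087,
  line `birth`,
# lead c1 devissage programme "discrete jumps": stub `formallySmooth_fractionRing_of_valuation`)

## What is proved

Let `k ⊆ L` be fields of characteristic `p > 0`, `a : ι → L` a finite family, `W` a valuation
ring of `L` and `F := k(a) = IntermediateField.adjoin k (Set.range a)`.  Assume

* `hind`: the monomials `a ^ α = ∏ i, a i ^ α i` with exponents `α : ι → Fin p` have
  `W`-valuations that are pairwise distinct modulo values of `p`-th powers, i.e.
  `v (a ^ α) ≠ v (h ^ p * a ^ β)` for `α ≠ β` and every `h : L`;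
* `hdec`: `F = F ^ p [a]`, i.e. every `x ∈ F` is `∑ α, c α ^ p * a ^ α` with `c α ∈ F`.

Then for every finitely generated `F`-subalgebra `B ⊆ L` the fraction field `Frac B` is formally
smooth over `F` (`formallySmooth_fractionRing_of_valuation`).

## Proof

This is Mac Lane's separability criterion [cite: StacksProject, Tag 030W] ("a `p`-basis of `F`
that stays `p`-independent in `L` makes `L / F` separable"), in the form provided by Mathlib's
`exists_isTranscendenceBasis_and_isSeparable_of_linearIndepOn_pow_of_essFiniteType`: it
suffices that `F`-linearly independent families of `Frac B` stay independent after raising to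
`p`-th powers.  Transporting along the injective `F`-algebra map `Frac B → L`, this is checked
in `L` (`linearIndependent_pow_of_valuation`): a relation `∑ c_x • x ^ p = 0` with `c_x ∈ F`
becomes, after expanding `c_x = ∑ α, c_{x,α} ^ p * a ^ α` and using Frobenius additivity,
`∑ α, g_α ^ p * a ^ α = 0` with `g_α = ∑ c_{x,α} x`.  By `hind` the nonzero terms have pairwise
distinct valuations, so a nonzero term would make the sum nonzero
(`sum_ne_zero_of_valuation_injOn`, `eq_zero_of_sum_pow_mul_monomial_eq_zero`); hence all
`g_α = 0`, and linear independence of the original family kills every `c_{x,α}`.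
Formal smoothness then follows from
`Algebra.FormallySmooth.of_algebraicIndependent_of_isSeparable`.

## Design notes

The transfer statement `formallySmooth_fractionRing_of_algHom` is phrased for an arbitrary
finite-type `F`-domain `R` embedding into `L` (rather than for `↥B` directly) to keep the
`IsScalarTower F R (FractionRing R)` instance search cheap; the registered statement is the
special case `R := ↥B`.  The `CharP`/`ExpChar` instances on `F` and `Frac R` are supplied by
hand because instance search for `CharP ↥F p` stops at the `ringChar` instance.
-/

-- single-problem summit: the doubled namespace component is forced
set_option linter.dupNamespace false

open scoped TensorProduct

namespace Summit.ResolutionOfSingularities.ResolutionOfSingularities.Theorems.ValuativeSmoothing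

section ValuationLemmas

variable {L Γ₀ : Type*} [Field L] [LinearOrderedCommGroupWithZero Γ₀] (v : Valuation L Γ₀)

/-- A finite nonempty sum of nonzero elements with pairwise distinct valuations is nonzero:
its valuation is the largest valuation of a summand. -/
theorem sum_ne_zero_of_valuation_injOn {σ : Type*} (s : Finset σ) (hs : s.Nonempty)
    (f : σ → L) (hf : ∀ i ∈ s, f i ≠ 0)
    (hinj : ∀ i ∈ s, ∀ j ∈ s, v (f i) = v (f j) → i = j) : ∑ i ∈ s, f i ≠ 0 := by
  classical
  obtain ⟨j, hj, hmax⟩ := Finset.exists_max_image s (fun i => v (f i)) hs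
  have hlt : ∀ i ∈ s \ {j}, v (f i) < v (f j) := by
    intro i hi
    rw [Finset.mem_sdiff, Finset.mem_singleton] at hi
    exact lt_of_le_of_ne (hmax i hi.1) (fun h => hi.2 (hinj i hi.1 j hj h))
  intro h0
  have := Valuation.map_sum_eq_of_lt v hj hlt
  rw [h0, map_zero] at this
  exact hf j hj ((Valuation.zero_iff v).mp this.symm)

end ValuationLemmas

section Setting

variable (p : ℕ) [Fact p.Prime] (k L : Type) [Field k] [CharP k p] [Field L] [Algebra k L]
  {ι : Type} [Fintype ι] [DecidableEq ι] (a : ι → L) (W : ValuationSubring L)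

/-- Valuation independence modulo `p`-th powers forces every generator to be nonzero. -/
theorem ne_zero_of_valuation_ne
    (hind : ∀ α β : ι → Fin p, α ≠ β → ∀ h : L,
      W.valuation (∏ i, a i ^ (α i : ℕ)) ≠ W.valuation (h ^ p * ∏ i, a i ^ (β i : ℕ)))
    (i : ι) : a i ≠ 0 := by
  have hp : p.Prime := Fact.out
  intro h0
  refine hind (Pi.single i ⟨1, hp.one_lt⟩) (fun _ => ⟨0, hp.pos⟩) ?_ 0 ?_
  · intro h
    have := congrFun h i
    simp [Fin.ext_iff] at this
  · rw [Finset.prod_eq_zero (Finset.mem_univ i) (by simp [h0]), zero_pow hp.ne_zero, zero_mul]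

/-- The monomials `∏ i, a i ^ α i` are nonzero. -/
theorem monomial_ne_zero
    (hind : ∀ α β : ι → Fin p, α ≠ β → ∀ h : L,
      W.valuation (∏ i, a i ^ (α i : ℕ)) ≠ W.valuation (h ^ p * ∏ i, a i ^ (β i : ℕ)))
    (α : ι → Fin p) : ∏ i, a i ^ (α i : ℕ) ≠ 0 :=
  Finset.prod_ne_zero_iff.mpr fun i _ => pow_ne_zero _ (ne_zero_of_valuation_ne p L a W hind i)

/-- Key step: a vanishing sum `∑ α, G α ^ p * a ^ α` has all coefficients `G α = 0`, because the
nonzero terms have pairwise distinct valuations. -/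
theorem eq_zero_of_sum_pow_mul_monomial_eq_zero
    (hind : ∀ α β : ι → Fin p, α ≠ β → ∀ h : L,
      W.valuation (∏ i, a i ^ (α i : ℕ)) ≠ W.valuation (h ^ p * ∏ i, a i ^ (β i : ℕ)))
    (G : (ι → Fin p) → L) (hG : ∑ α, G α ^ p * ∏ i, a i ^ (α i : ℕ) = 0) (α : ι → Fin p) :
    G α = 0 := by
  classical
  have hp : p.Prime := Fact.out
  by_contra hα
  set S : Finset (ι → Fin p) := Finset.univ.filter (fun β => G β ≠ 0) with hS_def
  have hS : S.Nonempty := ⟨α, by simp [hS_def, hα]⟩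
  have hsum : ∑ β ∈ S, G β ^ p * ∏ i, a i ^ (β i : ℕ) = 0 := by
    rw [hS_def, Finset.sum_filter_of_ne (fun β _ hβ => ?_), hG]
    intro h0
    rw [h0, zero_pow hp.ne_zero, zero_mul] at hβ
    exact hβ rfl
  refine sum_ne_zero_of_valuation_injOn W.valuation S hS _ (fun β hβ => ?_)
    (fun β hβ γ _ h => ?_) hsum
  · have hβ' : G β ≠ 0 := (Finset.mem_filter.mp hβ).2
    exact mul_ne_zero (pow_ne_zero _ hβ') (monomial_ne_zero p L a W hind β)
  · by_contra hne
    have hβ' : G β ≠ 0 := (Finset.mem_filter.mp hβ).2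
    apply hind β γ hne (G γ / G β)
    have h2 : W.valuation (G β ^ p) ≠ 0 := by simp [hβ']
    apply mul_left_cancel₀ h2
    rw [← map_mul, ← map_mul, h, ← mul_assoc, div_pow, ← mul_div_assoc,
      mul_div_cancel_left₀ _ (pow_ne_zero p hβ')]

/-- Mac Lane's condition in `L`: a family of `L` that is linearly independent over
`F = k(a)` stays linearly independent after raising to `p`-th powers. -/
theorem linearIndependent_pow_of_valuation
    (hind : ∀ α β : ι → Fin p, α ≠ β → ∀ h : L,
      W.valuation (∏ i, a i ^ (α i : ℕ)) ≠ W.valuation (h ^ p * ∏ i, a i ^ (β i : ℕ)))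
    (hdec : ∀ x ∈ IntermediateField.adjoin k (Set.range a), ∃ c : (ι → Fin p) → L,
      (∀ α, c α ∈ IntermediateField.adjoin k (Set.range a)) ∧
      x = ∑ α : ι → Fin p, c α ^ p * ∏ i, a i ^ ((α i : ℕ)))
    {σ : Type*} (v : σ → L)
    (hv : LinearIndependent (IntermediateField.adjoin k (Set.range a)) v) :
    LinearIndependent (IntermediateField.adjoin k (Set.range a)) (fun i => v i ^ p) := by
  have hp : p.Prime := Fact.out
  haveI : CharP L p := charP_of_injective_algebraMap (algebraMap k L).injective p
  haveI : ExpChar L p := ExpChar.prime hp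
  rw [linearIndependent_iff'] at hv ⊢
  intro s g hg i hi
  choose c hcF hc using fun i => hdec (g i) (g i).2
  have key : ∑ α : ι → Fin p, (∑ i ∈ s, c i α * v i) ^ p * ∏ j, a j ^ (α j : ℕ) = 0 := by
    calc ∑ α : ι → Fin p, (∑ i ∈ s, c i α * v i) ^ p * ∏ j, a j ^ (α j : ℕ)
        = ∑ α : ι → Fin p, ∑ i ∈ s, (c i α ^ p * ∏ j, a j ^ (α j : ℕ)) * v i ^ p := by
          refine Finset.sum_congr rfl fun α _ => ?_
          rw [sum_pow_char p, Finset.sum_mul]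
          refine Finset.sum_congr rfl fun i _ => ?_
          ring
      _ = ∑ i ∈ s, (g i : L) * v i ^ p := by
          rw [Finset.sum_comm]
          refine Finset.sum_congr rfl fun i _ => ?_
          rw [hc i, Finset.sum_mul]
      _ = 0 := by simpa [IntermediateField.smul_def, smul_eq_mul] using hg
  have hG := eq_zero_of_sum_pow_mul_monomial_eq_zero p L a W hind _ key
  have hc0 : ∀ α, ∀ i ∈ s, c i α = 0 := by
    intro α i hi
    have := hv s (fun i => ⟨c i α, hcF i α⟩) ?_ i hi
    · simpa using congrArg Subtype.val this
    · simpa [IntermediateField.smul_def, smul_eq_mul] using hG α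
  apply Subtype.ext
  rw [hc i]
  simp [hc0 _ i hi, hp.ne_zero]

/-- Separability transfer: a finitely generated `F`-domain that embeds into `L` has a fraction
field that is formally smooth (separably generated) over `F = k(a)`. -/
theorem formallySmooth_fractionRing_of_algHom
    (hind : ∀ α β : ι → Fin p, α ≠ β → ∀ h : L,
      W.valuation (∏ i, a i ^ (α i : ℕ)) ≠ W.valuation (h ^ p * ∏ i, a i ^ (β i : ℕ)))
    (hdec : ∀ x ∈ IntermediateField.adjoin k (Set.range a), ∃ c : (ι → Fin p) → L,
      (∀ α, c α ∈ IntermediateField.adjoin k (Set.range a)) ∧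
      x = ∑ α : ι → Fin p, c α ^ p * ∏ i, a i ^ ((α i : ℕ)))
    (R : Type*) [CommRing R] [IsDomain R] [Algebra (IntermediateField.adjoin k (Set.range a)) R]
    [Algebra.FiniteType (IntermediateField.adjoin k (Set.range a)) R]
    (g : R →ₐ[IntermediateField.adjoin k (Set.range a)] L) (hg : Function.Injective g) :
    Algebra.FormallySmooth (IntermediateField.adjoin k (Set.range a)) (FractionRing R) := by
  have hp : p.Prime := Fact.out
  haveI : CharP (IntermediateField.adjoin k (Set.range a)) p := IntermediateField.charP _ p
  haveI : ExpChar (IntermediateField.adjoin k (Set.range a)) p := ExpChar.prime hp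
  haveI : CharP (FractionRing R) p :=
    charP_of_injective_algebraMap
      (algebraMap (IntermediateField.adjoin k (Set.range a)) (FractionRing R)).injective p
  haveI : Algebra.EssFiniteType R (FractionRing R) :=
    .of_isLocalization (FractionRing R) (nonZeroDivisors R)
  haveI : Algebra.EssFiniteType (IntermediateField.adjoin k (Set.range a)) (FractionRing R) :=
    Algebra.EssFiniteType.comp (IntermediateField.adjoin k (Set.range a)) R (FractionRing R)
  let j : FractionRing R →ₐ[IntermediateField.adjoin k (Set.range a)] L :=
    IsFractionRing.liftAlgHom hg
  have hj : LinearMap.ker j.toLinearMap = ⊥ :=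
    LinearMap.ker_eq_bot.mpr j.toRingHom.injective
  obtain ⟨s, hs, hsep⟩ :=
    exists_isTranscendenceBasis_and_isSeparable_of_linearIndepOn_pow_of_essFiniteType
      (k := IntermediateField.adjoin k (Set.range a)) (K := FractionRing R) p hp (fun s hs => by
        have h1 := hs.map' j.toLinearMap hj
        have h2 := linearIndependent_pow_of_valuation p k L a W hind hdec _ h1
        refine LinearIndependent.of_comp j.toLinearMap ?_
        simpa [Function.comp_def, map_pow] using h2)
  have : Algebra.IsSeparable (IntermediateField.adjoin (IntermediateField.adjoin k (Set.range a))
      (Set.range ((↑) : s → FractionRing R))) (FractionRing R) := by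
    convert! hsep <;> simp
  exact .of_algebraicIndependent_of_isSeparable hs.1

/-- Stub C2: separability (formal smoothness of f.g. subextensions) from valuation
independence of the generators modulo `p`-th powers. -/
theorem formallySmooth_fractionRing_of_valuation (p : ℕ) [Fact p.Prime] (k L : Type) [Field k]
    [CharP k p] [Field L] [Algebra k L] {ι : Type} [Fintype ι] [DecidableEq ι] (a : ι → L)
    (W : ValuationSubring L)
    (hind : ∀ α β : ι → Fin p, α ≠ β → ∀ h : L,
      W.valuation (∏ i, a i ^ (α i : ℕ)) ≠ W.valuation (h ^ p * ∏ i, a i ^ (β i : ℕ)))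
    (hdec : ∀ x ∈ IntermediateField.adjoin k (Set.range a), ∃ c : (ι → Fin p) → L,
      (∀ α, c α ∈ IntermediateField.adjoin k (Set.range a)) ∧
      x = ∑ α : ι → Fin p, c α ^ p * ∏ i, a i ^ ((α i : ℕ)))
    (B : Subalgebra (IntermediateField.adjoin k (Set.range a)) L) (hB : B.FG) :
    Algebra.FormallySmooth (IntermediateField.adjoin k (Set.range a)) (FractionRing B) := by
  haveI : Algebra.FiniteType (IntermediateField.adjoin k (Set.range a)) B :=
    B.fg_iff_finiteType.mp hB
  exact formallySmooth_fractionRing_of_algHom p k L a W hind hdec B B.val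
    (fun _ _ h => Subtype.ext h)

end Setting

end Summit.ResolutionOfSingularities.ResolutionOfSingularities.Theorems.ValuativeSmoothing
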